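import Summits.BirchSwinnertonDyer.BirchSwinnertonDyer.Theorems.KolyvaginDepthDoorDepthTableRankTwo446d1TwistBSDQuotientUniform
import Summits.BirchSwinnertonDyer.BirchSwinnertonDyer.Theorems.KolyvaginDepthDoorDepthTableRankTwo655a1TwistBSDQuotientUniform
import Summits.BirchSwinnertonDyer.BirchSwinnertonDyer.Theorems.KolyvaginDepthDoorDepthTableRankTwo681c1TwistBSDQuotientUniform
import Summits.BirchSwinnertonDyer.BirchSwinnertonDyer.Theorems.KolyvaginDepthDoorDepthTableRowsIntrinsic4
import Summits.BirchSwinnertonDyer.BirchSwinnertonDyer.Theorems.KolyvaginDepthDoorDepthTableIntrinsicZhang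
import Summits.BirchSwinnertonDyer.BirchSwinnertonDyer.Theorems.Rank1ResidualIntModelReduction
import HarnessLib

/-!
# Route `KolyvaginDepthDoor`, crux `KolyvaginDepthSupplyKN` (stmt-BirchSwinnertonDyer-22820) —
# DEPTH TABLE v16: W. ZHANG'S SECOND ROAD (Thm. 1.6, Beilinson–Flach-free) for `446d1`, `655a1`, `681c1`, `707a1` — INTRINSIC, uniform in the Heegner field and the prime

Helper file of the lead prover of line `levelone` (kdd-p1 g20; `--supports stmt-BirchSwinnertonDyer-22820
--as helper`); it closes nothing and BSD is NOT proved by it.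

g19's `…RankTwo<label>TwistBSDQuotientZhang` certified W. Zhang's Thm. 1.4 (2)–(3) per twist model at the field of record. Here
(`cruxBody_of_twistBSDQuotient_intrinsic_zhang`, `…DepthTableIntrinsicZhang`): the curves below have TWO multiplicative primes (kernel, from the
integer model), so (2)–(3) hold for ANY minimal model of ANY Heegner twist with odd square-free `d_K` — the multiplicative primes of the twist are the
curve's (`multiplicative_iff_and_padicValInt_eq_of_heegnerTwist`). Per curve: for EVERY admissible `5 ≤ p < 1000`, EVERY such `K` with `p ∤ d_K`, ANY
minimal twist model `T`: «`r_an(E^{(d_K)}) = 1 ∧ ord_p(L'(T,1)/(Ω_T Reg_T)) ≤ 1`» ⟹ the clause of `KolyvaginDepthSupplyKN` at the curve VERBATIM, via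
W. Zhang 2014 Thm. 1.6 instead of Burungale–Castella–Skinner 2025.

CONDITIONAL on Stein–Wuthrich 2013 Thm. 1.1, W. Zhang 2014 L8.4 (1) / 9.1 and Thm. 1.6, GZK, BY NAME; per curve; nothing class-wide (the open stub
(S♭) is untouched); BSD is NOT proved by any of this.

References: [WZhang2014] Thm. 1.4, Thm. 1.6, L8.4 (1), Thm. 9.1; [SteinWuthrich2013] Thm. 1.1; [Darmon2004] Thm. 3.22; [CremonaAlgorithms1997] Table 1.
-/

set_option linter.dupNamespace false

noncomputable section

open scoped Classical NumberField

namespace Summit.BirchSwinnertonDyer.BirchSwinnertonDyer.Theorems.KolyvaginDepthDoor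

open Literature.NumberTheory.EllipticCurves Literature.NumberTheory.EllipticCurves.ModularForms
  WeierstrassCurve NumberField IsDedekindDomain
open Summit.BirchSwinnertonDyer.BirchSwinnertonDyer.Theorems
open Summit.BirchSwinnertonDyer.BirchSwinnertonDyer.Rank2Observatory
open Summit.BirchSwinnertonDyer.BirchSwinnertonDyer.Rank1Residual
open Summit.BirchSwinnertonDyer.Rank1Residual.Additive

namespace C446d1

/-- **THE CRUX `KolyvaginDepthSupplyKN` AT `446d1` ON W. ZHANG'S SECOND ROAD (Thm. 1.6, Beilinson–Flach-free), INTRINSIC, UNIFORM IN `K` AND `p`** (depth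
table v16). `446d1` has the two multiplicative primes `2`, `223` (kernel: `Δ`, `c₄` of the integer model), so Zhang's Thm. 1.4 (2)–(3) hold for EVERY minimal model
of EVERY Heegner twist with odd `d_K` (`multiplicative_iff_and_padicValInt_eq_of_heegnerTwist`). For every admissible `5 ≤ p < 1000` (good ordinary, `ρ_{E,p^n}` onto —
hypotheses), every imaginary quadratic `K` (`d_K` odd square-free, `∉ {−3,−4}`, `p ∤ d_K`, Heegner for `N = 446`) and ANY globally minimal model `T` of
`E^{(d_K)}`: «`ord_{s=1} L(E^{(d_K)}, s) = 1` ∧ `ord_p(L'(T,1)/(Ω_T·Reg_T)) ≤ 1`» ⟹ the clause of `KolyvaginDepthSupplyKN` at `W = 446d1` VERBATIM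
(`cruxBody_of_twistBSDQuotient_intrinsic_zhang`). CONDITIONAL on Stein–Wuthrich Thm. 1.1, W. Zhang L8.4 (1) / 9.1 and Thm. 1.6, GZK by name; per curve;
nothing class-wide; BSD is not proved by it. [cite: WZhang2014, Thm. 1.6 (p. 199), Thm. 1.4 (2)–(3) (p. 197)] [cite: SteinWuthrich2013, Thm. 1.1 (p. 1758)]
[cite: CremonaAlgorithms1997, Table 1 (446d1)] -/
theorem cruxBody_intrinsic_zhang_at
    (hSW : SteinWuthrich2013_sha_inf_torsionBy_eq_bot_of_two_le_rank)
    (h84 : Literature.NumberTheory.EllipticCurves.WZhang2014_lemma84_exists_minimal_kolyvaginClass_one_selmerCard)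
    (hZ : WZhang2014_padicValRat_bsd_rank_one_ordinary) (hGZK : rank_eq_analyticRank_of_analyticRank_le_one)
    (p : ℕ) [hp : Fact p.Prime] (h5 : 5 ≤ p) (hp1000 : p < 1000)
    (hgood : haveI := isElliptic_c446d1; haveI := isGloballyMinimal_c446d1; ((⟨1, -1, 0, -4, 4⟩ : WeierstrassCurve ℤ).map (Int.castRingHom ℚ)).HasGoodReductionAtPrime p)
    (hord : haveI := isElliptic_c446d1; haveI := isGloballyMinimal_c446d1; ¬ (p : ℤ) ∣ ((⟨1, -1, 0, -4, 4⟩ : WeierstrassCurve ℤ).map (Int.castRingHom ℚ)).frobeniusTrace p)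
    (htower : haveI := isElliptic_c446d1; haveI := isGloballyMinimal_c446d1; ∀ n : ℕ, ((⟨1, -1, 0, -4, 4⟩ : WeierstrassCurve ℤ).map (Int.castRingHom ℚ)).HasSurjectiveModNGaloisRep (p ^ n : ℕ))
    (K : Type) [Field K] [NumberField K] (hK : IsImaginaryQuadratic K)
    (hodd : Odd (NumberField.discr K)) (hsqf : Squarefree (NumberField.discr K))
    (hD3 : NumberField.discr K ≠ -3) (hD4 : NumberField.discr K ≠ -4) (hpD : ¬ ((p : ℤ) ∣ NumberField.discr K))
    (hH : SatisfiesHeegnerHypothesis 446 K)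
    (T : WeierstrassCurve ℚ) [T.IsElliptic] [T.IsGloballyMinimal] (C : WeierstrassCurve.VariableChange ℚ)
    (hC : C • T = ((⟨1, -1, 0, -4, 4⟩ : WeierstrassCurve ℤ).map (Int.castRingHom ℚ)).quadraticTwist (NumberField.discr K : ℚ))
    (hTr : (((⟨1, -1, 0, -4, 4⟩ : WeierstrassCurve ℤ).map (Int.castRingHom ℚ)).quadraticTwist (NumberField.discr K : ℚ)).analyticRank = 1)
    (hval : ∀ q : ℚ, T.leadingLCoeff / ((T.realPeriodRat * T.regulator : ℝ) : ℂ) = (q : ℂ) → padicValRat p q ≤ 1) :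
    haveI := isElliptic_c446d1; haveI := isGloballyMinimal_c446d1;
    ∃ (p : ℕ) (hp : Fact p.Prime), 5 ≤ p ∧ ((⟨1, -1, 0, -4, 4⟩ : WeierstrassCurve ℤ).map (Int.castRingHom ℚ)).HasGoodReductionAtPrime p ∧
      ¬ (p : ℤ) ∣ ((⟨1, -1, 0, -4, 4⟩ : WeierstrassCurve ℤ).map (Int.castRingHom ℚ)).frobeniusTrace p ∧ (∀ n : ℕ, ((⟨1, -1, 0, -4, 4⟩ : WeierstrassCurve ℤ).map (Int.castRingHom ℚ)).HasSurjectiveModNGaloisRep (p ^ n : ℕ)) ∧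
      (∀ v : HeightOneSpectrum (𝓞 ℚ), ((⟨1, -1, 0, -4, 4⟩ : WeierstrassCurve ℤ).map (Int.castRingHom ℚ)).HasMultiplicativeReductionAt v →
        ¬ p ∣ ((⟨1, -1, 0, -4, 4⟩ : WeierstrassCurve ℤ).map (Int.castRingHom ℚ)).ordMinimalDiscriminant v) ∧
      ∃ (K : Type) (_ : Field K) (_ : NumberField K), IsImaginaryQuadratic K ∧
        NumberField.discr K ≠ -3 ∧ NumberField.discr K ≠ -4 ∧
        ∃ (_ : NeZero (((⟨1, -1, 0, -4, 4⟩ : WeierstrassCurve ℤ).map (Int.castRingHom ℚ)).conductorNorm ℤ)), SatisfiesHeegnerHypothesis (((⟨1, -1, 0, -4, 4⟩ : WeierstrassCurve ℤ).map (Int.castRingHom ℚ)).conductorNorm ℤ) K ∧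
        ∃ (Dt : ModularParametrizationData ((⟨1, -1, 0, -4, 4⟩ : WeierstrassCurve ℤ).map (Int.castRingHom ℚ)) (((⟨1, -1, 0, -4, 4⟩ : WeierstrassCurve ℤ).map (Int.castRingHom ℚ)).conductorNorm ℤ)) (β : ℤ) (ι : K →+* ℂ) (n₁ : ℕ)
          (d : KolyvaginHeegnerData Dt β ι n₁), Squarefree n₁ ∧
          (∀ q ∈ n₁.primeFactors, Zhang2014.IsKolyvaginPrime (((⟨1, -1, 0, -4, 4⟩ : WeierstrassCurve ℤ).map (Int.castRingHom ℚ)).conductorNorm ℤ) ((⟨1, -1, 0, -4, 4⟩ : WeierstrassCurve ℤ).map (Int.castRingHom ℚ)) K p q) ∧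
          d.kolyvaginClass hp.out 1 ≠ 0 ∧
          (n₁.primeFactors.card + 1 ≤ ((⟨1, -1, 0, -4, 4⟩ : WeierstrassCurve ℤ).map (Int.castRingHom ℚ)).mordellWeilRank ∨
            (n₁.primeFactors.card ≤ ((⟨1, -1, 0, -4, 4⟩ : WeierstrassCurve ℤ).map (Int.castRingHom ℚ)).mordellWeilRank ∧
              n₁.primeFactors.card + 1 ≤ (((⟨1, -1, 0, -4, 4⟩ : WeierstrassCurve ℤ).map (Int.castRingHom ℚ)).quadraticTwist (NumberField.discr K : ℚ)).mordellWeilRank)) := by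
  haveI := isElliptic_c446d1; haveI := isGloballyMinimal_c446d1
  haveI iNZ : NeZero (((⟨1, -1, 0, -4, 4⟩ : WeierstrassCurve ℤ).map (Int.castRingHom ℚ)).conductorNorm ℤ) := neZero_conductorNorm_of_isElliptic _
  have hsp := spadeOne_of_five_le p h5
  have hHN : SatisfiesHeegnerHypothesis (((⟨1, -1, 0, -4, 4⟩ : WeierstrassCurve ℤ).map (Int.castRingHom ℚ)).conductorNorm ℤ) K := by rw [conductorNorm_eq]; exact hH
  have htwo : ∃ (ℓ₁ ℓ₂ : ℕ) (_ : Fact ℓ₁.Prime) (_ : Fact ℓ₂.Prime), ℓ₁ ≠ ℓ₂ ∧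
      ((⟨1, -1, 0, -4, 4⟩ : WeierstrassCurve ℤ).map (Int.castRingHom ℚ)).HasMultiplicativeReductionAtPrime ℓ₁ ∧ ((⟨1, -1, 0, -4, 4⟩ : WeierstrassCurve ℤ).map (Int.castRingHom ℚ)).HasMultiplicativeReductionAtPrime ℓ₂ := by
    haveI i₁ := Fact.mk (by norm_num : Nat.Prime 2)
    haveI i₂ := Fact.mk (by norm_num : Nat.Prime 223)
    exact ⟨2, 223, i₁, i₂, by norm_num,
      IntModel.hasMultiplicativeReductionAtPrime_of_intModel intModel 2 (by decide +kernel) (by decide +kernel),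
      IntModel.hasMultiplicativeReductionAtPrime_of_intModel intModel 223 (by decide +kernel) (by decide +kernel)⟩
  exact cruxBody_of_twistBSDQuotient_intrinsic_zhang hSW h84 hZ hGZK _ not_hasCM KernelCerts001.C446d1.two_le_rank (by rw [conductorNorm_eq]; norm_num) p h5 hp1000
    hgood hord htower (kodairaNeron_of_five_le p h5) hsp.1 htwo K hK hodd hsqf hD3 hD4 hpD hHN T C hC hTr 1 KernelCerts001.C446d1.two_le_rank hval

end C446d1

namespace C655a1

/-- **THE CRUX `KolyvaginDepthSupplyKN` AT `655a1` ON W. ZHANG'S SECOND ROAD (Thm. 1.6, Beilinson–Flach-free), INTRINSIC, UNIFORM IN `K` AND `p`** (depth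
table v16). `655a1` has the two multiplicative primes `5`, `131` (kernel: `Δ`, `c₄` of the integer model), so Zhang's Thm. 1.4 (2)–(3) hold for EVERY minimal model
of EVERY Heegner twist with odd `d_K` (`multiplicative_iff_and_padicValInt_eq_of_heegnerTwist`). For every admissible `5 ≤ p < 1000` (good ordinary, `ρ_{E,p^n}` onto —
hypotheses), every imaginary quadratic `K` (`d_K` odd square-free, `∉ {−3,−4}`, `p ∤ d_K`, Heegner for `N = 655`) and ANY globally minimal model `T` of
`E^{(d_K)}`: «`ord_{s=1} L(E^{(d_K)}, s) = 1` ∧ `ord_p(L'(T,1)/(Ω_T·Reg_T)) ≤ 1`» ⟹ the clause of `KolyvaginDepthSupplyKN` at `W = 655a1` VERBATIM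
(`cruxBody_of_twistBSDQuotient_intrinsic_zhang`). CONDITIONAL on Stein–Wuthrich Thm. 1.1, W. Zhang L8.4 (1) / 9.1 and Thm. 1.6, GZK by name; per curve;
nothing class-wide; BSD is not proved by it. [cite: WZhang2014, Thm. 1.6 (p. 199), Thm. 1.4 (2)–(3) (p. 197)] [cite: SteinWuthrich2013, Thm. 1.1 (p. 1758)]
[cite: CremonaAlgorithms1997, Table 1 (655a1)] -/
theorem cruxBody_intrinsic_zhang_at
    (hSW : SteinWuthrich2013_sha_inf_torsionBy_eq_bot_of_two_le_rank)
    (h84 : Literature.NumberTheory.EllipticCurves.WZhang2014_lemma84_exists_minimal_kolyvaginClass_one_selmerCard)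
    (hZ : WZhang2014_padicValRat_bsd_rank_one_ordinary) (hGZK : rank_eq_analyticRank_of_analyticRank_le_one)
    (p : ℕ) [hp : Fact p.Prime] (h5 : 5 ≤ p) (hp1000 : p < 1000)
    (hgood : haveI := isElliptic_c655a1; haveI := isGloballyMinimal_c655a1; ((⟨0, 0, 1, -13, 18⟩ : WeierstrassCurve ℤ).map (Int.castRingHom ℚ)).HasGoodReductionAtPrime p)
    (hord : haveI := isElliptic_c655a1; haveI := isGloballyMinimal_c655a1; ¬ (p : ℤ) ∣ ((⟨0, 0, 1, -13, 18⟩ : WeierstrassCurve ℤ).map (Int.castRingHom ℚ)).frobeniusTrace p)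
    (htower : haveI := isElliptic_c655a1; haveI := isGloballyMinimal_c655a1; ∀ n : ℕ, ((⟨0, 0, 1, -13, 18⟩ : WeierstrassCurve ℤ).map (Int.castRingHom ℚ)).HasSurjectiveModNGaloisRep (p ^ n : ℕ))
    (K : Type) [Field K] [NumberField K] (hK : IsImaginaryQuadratic K)
    (hodd : Odd (NumberField.discr K)) (hsqf : Squarefree (NumberField.discr K))
    (hD3 : NumberField.discr K ≠ -3) (hD4 : NumberField.discr K ≠ -4) (hpD : ¬ ((p : ℤ) ∣ NumberField.discr K))
    (hH : SatisfiesHeegnerHypothesis 655 K)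
    (T : WeierstrassCurve ℚ) [T.IsElliptic] [T.IsGloballyMinimal] (C : WeierstrassCurve.VariableChange ℚ)
    (hC : C • T = ((⟨0, 0, 1, -13, 18⟩ : WeierstrassCurve ℤ).map (Int.castRingHom ℚ)).quadraticTwist (NumberField.discr K : ℚ))
    (hTr : (((⟨0, 0, 1, -13, 18⟩ : WeierstrassCurve ℤ).map (Int.castRingHom ℚ)).quadraticTwist (NumberField.discr K : ℚ)).analyticRank = 1)
    (hval : ∀ q : ℚ, T.leadingLCoeff / ((T.realPeriodRat * T.regulator : ℝ) : ℂ) = (q : ℂ) → padicValRat p q ≤ 1) :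
    haveI := isElliptic_c655a1; haveI := isGloballyMinimal_c655a1;
    ∃ (p : ℕ) (hp : Fact p.Prime), 5 ≤ p ∧ ((⟨0, 0, 1, -13, 18⟩ : WeierstrassCurve ℤ).map (Int.castRingHom ℚ)).HasGoodReductionAtPrime p ∧
      ¬ (p : ℤ) ∣ ((⟨0, 0, 1, -13, 18⟩ : WeierstrassCurve ℤ).map (Int.castRingHom ℚ)).frobeniusTrace p ∧ (∀ n : ℕ, ((⟨0, 0, 1, -13, 18⟩ : WeierstrassCurve ℤ).map (Int.castRingHom ℚ)).HasSurjectiveModNGaloisRep (p ^ n : ℕ)) ∧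
      (∀ v : HeightOneSpectrum (𝓞 ℚ), ((⟨0, 0, 1, -13, 18⟩ : WeierstrassCurve ℤ).map (Int.castRingHom ℚ)).HasMultiplicativeReductionAt v →
        ¬ p ∣ ((⟨0, 0, 1, -13, 18⟩ : WeierstrassCurve ℤ).map (Int.castRingHom ℚ)).ordMinimalDiscriminant v) ∧
      ∃ (K : Type) (_ : Field K) (_ : NumberField K), IsImaginaryQuadratic K ∧
        NumberField.discr K ≠ -3 ∧ NumberField.discr K ≠ -4 ∧
        ∃ (_ : NeZero (((⟨0, 0, 1, -13, 18⟩ : WeierstrassCurve ℤ).map (Int.castRingHom ℚ)).conductorNorm ℤ)), SatisfiesHeegnerHypothesis (((⟨0, 0, 1, -13, 18⟩ : WeierstrassCurve ℤ).map (Int.castRingHom ℚ)).conductorNorm ℤ) K ∧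
        ∃ (Dt : ModularParametrizationData ((⟨0, 0, 1, -13, 18⟩ : WeierstrassCurve ℤ).map (Int.castRingHom ℚ)) (((⟨0, 0, 1, -13, 18⟩ : WeierstrassCurve ℤ).map (Int.castRingHom ℚ)).conductorNorm ℤ)) (β : ℤ) (ι : K →+* ℂ) (n₁ : ℕ)
          (d : KolyvaginHeegnerData Dt β ι n₁), Squarefree n₁ ∧
          (∀ q ∈ n₁.primeFactors, Zhang2014.IsKolyvaginPrime (((⟨0, 0, 1, -13, 18⟩ : WeierstrassCurve ℤ).map (Int.castRingHom ℚ)).conductorNorm ℤ) ((⟨0, 0, 1, -13, 18⟩ : WeierstrassCurve ℤ).map (Int.castRingHom ℚ)) K p q) ∧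
          d.kolyvaginClass hp.out 1 ≠ 0 ∧
          (n₁.primeFactors.card + 1 ≤ ((⟨0, 0, 1, -13, 18⟩ : WeierstrassCurve ℤ).map (Int.castRingHom ℚ)).mordellWeilRank ∨
            (n₁.primeFactors.card ≤ ((⟨0, 0, 1, -13, 18⟩ : WeierstrassCurve ℤ).map (Int.castRingHom ℚ)).mordellWeilRank ∧
              n₁.primeFactors.card + 1 ≤ (((⟨0, 0, 1, -13, 18⟩ : WeierstrassCurve ℤ).map (Int.castRingHom ℚ)).quadraticTwist (NumberField.discr K : ℚ)).mordellWeilRank)) := by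
  haveI := isElliptic_c655a1; haveI := isGloballyMinimal_c655a1
  haveI iNZ : NeZero (((⟨0, 0, 1, -13, 18⟩ : WeierstrassCurve ℤ).map (Int.castRingHom ℚ)).conductorNorm ℤ) := neZero_conductorNorm_of_isElliptic _
  have hsp := spadeOne_of_five_le p h5
  have hHN : SatisfiesHeegnerHypothesis (((⟨0, 0, 1, -13, 18⟩ : WeierstrassCurve ℤ).map (Int.castRingHom ℚ)).conductorNorm ℤ) K := by rw [conductorNorm_eq]; exact hH
  have htwo : ∃ (ℓ₁ ℓ₂ : ℕ) (_ : Fact ℓ₁.Prime) (_ : Fact ℓ₂.Prime), ℓ₁ ≠ ℓ₂ ∧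
      ((⟨0, 0, 1, -13, 18⟩ : WeierstrassCurve ℤ).map (Int.castRingHom ℚ)).HasMultiplicativeReductionAtPrime ℓ₁ ∧ ((⟨0, 0, 1, -13, 18⟩ : WeierstrassCurve ℤ).map (Int.castRingHom ℚ)).HasMultiplicativeReductionAtPrime ℓ₂ := by
    haveI i₁ := Fact.mk (by norm_num : Nat.Prime 5)
    haveI i₂ := Fact.mk (by norm_num : Nat.Prime 131)
    exact ⟨5, 131, i₁, i₂, by norm_num,
      IntModel.hasMultiplicativeReductionAtPrime_of_intModel intModel 5 (by decide +kernel) (by decide +kernel),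
      IntModel.hasMultiplicativeReductionAtPrime_of_intModel intModel 131 (by decide +kernel) (by decide +kernel)⟩
  exact cruxBody_of_twistBSDQuotient_intrinsic_zhang hSW h84 hZ hGZK _ not_hasCM KernelCerts001.C655a1.two_le_rank (by rw [conductorNorm_eq]; norm_num) p h5 hp1000
    hgood hord htower (kodairaNeron_of_five_le p h5) hsp.1 htwo K hK hodd hsqf hD3 hD4 hpD hHN T C hC hTr 1 KernelCerts001.C655a1.two_le_rank hval

end C655a1

namespace C681c1

/-- **THE CRUX `KolyvaginDepthSupplyKN` AT `681c1` ON W. ZHANG'S SECOND ROAD (Thm. 1.6, Beilinson–Flach-free), INTRINSIC, UNIFORM IN `K` AND `p`** (depth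
table v16). `681c1` has the two multiplicative primes `3`, `227` (kernel: `Δ`, `c₄` of the integer model), so Zhang's Thm. 1.4 (2)–(3) hold for EVERY minimal model
of EVERY Heegner twist with odd `d_K` (`multiplicative_iff_and_padicValInt_eq_of_heegnerTwist`). For every admissible `5 ≤ p < 1000` (good ordinary, `ρ_{E,p^n}` onto —
hypotheses), every imaginary quadratic `K` (`d_K` odd square-free, `∉ {−3,−4}`, `p ∤ d_K`, Heegner for `N = 681`) and ANY globally minimal model `T` of
`E^{(d_K)}`: «`ord_{s=1} L(E^{(d_K)}, s) = 1` ∧ `ord_p(L'(T,1)/(Ω_T·Reg_T)) ≤ 1`» ⟹ the clause of `KolyvaginDepthSupplyKN` at `W = 681c1` VERBATIM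
(`cruxBody_of_twistBSDQuotient_intrinsic_zhang`). CONDITIONAL on Stein–Wuthrich Thm. 1.1, W. Zhang L8.4 (1) / 9.1 and Thm. 1.6, GZK by name; per curve;
nothing class-wide; BSD is not proved by it. [cite: WZhang2014, Thm. 1.6 (p. 199), Thm. 1.4 (2)–(3) (p. 197)] [cite: SteinWuthrich2013, Thm. 1.1 (p. 1758)]
[cite: CremonaAlgorithms1997, Table 1 (681c1)] -/
theorem cruxBody_intrinsic_zhang_at
    (hSW : SteinWuthrich2013_sha_inf_torsionBy_eq_bot_of_two_le_rank)
    (h84 : Literature.NumberTheory.EllipticCurves.WZhang2014_lemma84_exists_minimal_kolyvaginClass_one_selmerCard)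
    (hZ : WZhang2014_padicValRat_bsd_rank_one_ordinary) (hGZK : rank_eq_analyticRank_of_analyticRank_le_one)
    (p : ℕ) [hp : Fact p.Prime] (h5 : 5 ≤ p) (hp1000 : p < 1000)
    (hgood : haveI := isElliptic_c681c1; haveI := isGloballyMinimal_c681c1; ((⟨0, -1, 1, 0, 2⟩ : WeierstrassCurve ℤ).map (Int.castRingHom ℚ)).HasGoodReductionAtPrime p)
    (hord : haveI := isElliptic_c681c1; haveI := isGloballyMinimal_c681c1; ¬ (p : ℤ) ∣ ((⟨0, -1, 1, 0, 2⟩ : WeierstrassCurve ℤ).map (Int.castRingHom ℚ)).frobeniusTrace p)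
    (htower : haveI := isElliptic_c681c1; haveI := isGloballyMinimal_c681c1; ∀ n : ℕ, ((⟨0, -1, 1, 0, 2⟩ : WeierstrassCurve ℤ).map (Int.castRingHom ℚ)).HasSurjectiveModNGaloisRep (p ^ n : ℕ))
    (K : Type) [Field K] [NumberField K] (hK : IsImaginaryQuadratic K)
    (hodd : Odd (NumberField.discr K)) (hsqf : Squarefree (NumberField.discr K))
    (hD3 : NumberField.discr K ≠ -3) (hD4 : NumberField.discr K ≠ -4) (hpD : ¬ ((p : ℤ) ∣ NumberField.discr K))
    (hH : SatisfiesHeegnerHypothesis 681 K)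
    (T : WeierstrassCurve ℚ) [T.IsElliptic] [T.IsGloballyMinimal] (C : WeierstrassCurve.VariableChange ℚ)
    (hC : C • T = ((⟨0, -1, 1, 0, 2⟩ : WeierstrassCurve ℤ).map (Int.castRingHom ℚ)).quadraticTwist (NumberField.discr K : ℚ))
    (hTr : (((⟨0, -1, 1, 0, 2⟩ : WeierstrassCurve ℤ).map (Int.castRingHom ℚ)).quadraticTwist (NumberField.discr K : ℚ)).analyticRank = 1)
    (hval : ∀ q : ℚ, T.leadingLCoeff / ((T.realPeriodRat * T.regulator : ℝ) : ℂ) = (q : ℂ) → padicValRat p q ≤ 1) :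
    haveI := isElliptic_c681c1; haveI := isGloballyMinimal_c681c1;
    ∃ (p : ℕ) (hp : Fact p.Prime), 5 ≤ p ∧ ((⟨0, -1, 1, 0, 2⟩ : WeierstrassCurve ℤ).map (Int.castRingHom ℚ)).HasGoodReductionAtPrime p ∧
      ¬ (p : ℤ) ∣ ((⟨0, -1, 1, 0, 2⟩ : WeierstrassCurve ℤ).map (Int.castRingHom ℚ)).frobeniusTrace p ∧ (∀ n : ℕ, ((⟨0, -1, 1, 0, 2⟩ : WeierstrassCurve ℤ).map (Int.castRingHom ℚ)).HasSurjectiveModNGaloisRep (p ^ n : ℕ)) ∧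
      (∀ v : HeightOneSpectrum (𝓞 ℚ), ((⟨0, -1, 1, 0, 2⟩ : WeierstrassCurve ℤ).map (Int.castRingHom ℚ)).HasMultiplicativeReductionAt v →
        ¬ p ∣ ((⟨0, -1, 1, 0, 2⟩ : WeierstrassCurve ℤ).map (Int.castRingHom ℚ)).ordMinimalDiscriminant v) ∧
      ∃ (K : Type) (_ : Field K) (_ : NumberField K), IsImaginaryQuadratic K ∧
        NumberField.discr K ≠ -3 ∧ NumberField.discr K ≠ -4 ∧
        ∃ (_ : NeZero (((⟨0, -1, 1, 0, 2⟩ : WeierstrassCurve ℤ).map (Int.castRingHom ℚ)).conductorNorm ℤ)), SatisfiesHeegnerHypothesis (((⟨0, -1, 1, 0, 2⟩ : WeierstrassCurve ℤ).map (Int.castRingHom ℚ)).conductorNorm ℤ) K ∧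
        ∃ (Dt : ModularParametrizationData ((⟨0, -1, 1, 0, 2⟩ : WeierstrassCurve ℤ).map (Int.castRingHom ℚ)) (((⟨0, -1, 1, 0, 2⟩ : WeierstrassCurve ℤ).map (Int.castRingHom ℚ)).conductorNorm ℤ)) (β : ℤ) (ι : K →+* ℂ) (n₁ : ℕ)
          (d : KolyvaginHeegnerData Dt β ι n₁), Squarefree n₁ ∧
          (∀ q ∈ n₁.primeFactors, Zhang2014.IsKolyvaginPrime (((⟨0, -1, 1, 0, 2⟩ : WeierstrassCurve ℤ).map (Int.castRingHom ℚ)).conductorNorm ℤ) ((⟨0, -1, 1, 0, 2⟩ : WeierstrassCurve ℤ).map (Int.castRingHom ℚ)) K p q) ∧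
          d.kolyvaginClass hp.out 1 ≠ 0 ∧
          (n₁.primeFactors.card + 1 ≤ ((⟨0, -1, 1, 0, 2⟩ : WeierstrassCurve ℤ).map (Int.castRingHom ℚ)).mordellWeilRank ∨
            (n₁.primeFactors.card ≤ ((⟨0, -1, 1, 0, 2⟩ : WeierstrassCurve ℤ).map (Int.castRingHom ℚ)).mordellWeilRank ∧
              n₁.primeFactors.card + 1 ≤ (((⟨0, -1, 1, 0, 2⟩ : WeierstrassCurve ℤ).map (Int.castRingHom ℚ)).quadraticTwist (NumberField.discr K : ℚ)).mordellWeilRank)) := by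
  haveI := isElliptic_c681c1; haveI := isGloballyMinimal_c681c1
  haveI iNZ : NeZero (((⟨0, -1, 1, 0, 2⟩ : WeierstrassCurve ℤ).map (Int.castRingHom ℚ)).conductorNorm ℤ) := neZero_conductorNorm_of_isElliptic _
  have hsp := spadeOne_of_five_le p h5
  have hHN : SatisfiesHeegnerHypothesis (((⟨0, -1, 1, 0, 2⟩ : WeierstrassCurve ℤ).map (Int.castRingHom ℚ)).conductorNorm ℤ) K := by rw [conductorNorm_eq]; exact hH
  have htwo : ∃ (ℓ₁ ℓ₂ : ℕ) (_ : Fact ℓ₁.Prime) (_ : Fact ℓ₂.Prime), ℓ₁ ≠ ℓ₂ ∧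
      ((⟨0, -1, 1, 0, 2⟩ : WeierstrassCurve ℤ).map (Int.castRingHom ℚ)).HasMultiplicativeReductionAtPrime ℓ₁ ∧ ((⟨0, -1, 1, 0, 2⟩ : WeierstrassCurve ℤ).map (Int.castRingHom ℚ)).HasMultiplicativeReductionAtPrime ℓ₂ := by
    haveI i₁ := Fact.mk (by norm_num : Nat.Prime 3)
    haveI i₂ := Fact.mk (by norm_num : Nat.Prime 227)
    exact ⟨3, 227, i₁, i₂, by norm_num,
      IntModel.hasMultiplicativeReductionAtPrime_of_intModel intModel 3 (by decide +kernel) (by decide +kernel),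
      IntModel.hasMultiplicativeReductionAtPrime_of_intModel intModel 227 (by decide +kernel) (by decide +kernel)⟩
  exact cruxBody_of_twistBSDQuotient_intrinsic_zhang hSW h84 hZ hGZK _ not_hasCM KernelCerts002.C681c1.two_le_rank (by rw [conductorNorm_eq]; norm_num) p h5 hp1000
    hgood hord htower (kodairaNeron_of_five_le p h5) hsp.1 htwo K hK hodd hsqf hD3 hD4 hpD hHN T C hC hTr 1 KernelCerts002.C681c1.two_le_rank hval

end C681c1

namespace C707a1

/-- **THE CRUX `KolyvaginDepthSupplyKN` AT `707a1` ON W. ZHANG'S SECOND ROAD (Thm. 1.6, Beilinson–Flach-free), INTRINSIC, UNIFORM IN `K` AND `p`** (depth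
table v16). `707a1` has the two multiplicative primes `7`, `101` (kernel: `Δ`, `c₄` of the integer model), so Zhang's Thm. 1.4 (2)–(3) hold for EVERY minimal model
of EVERY Heegner twist with odd `d_K` (`multiplicative_iff_and_padicValInt_eq_of_heegnerTwist`). For every admissible `5 ≤ p < 1000` (good ordinary, `ρ_{E,p^n}` onto —
hypotheses), every imaginary quadratic `K` (`d_K` odd square-free, `∉ {−3,−4}`, `p ∤ d_K`, Heegner for `N = 707`) and ANY globally minimal model `T` of
`E^{(d_K)}`: «`ord_{s=1} L(E^{(d_K)}, s) = 1` ∧ `ord_p(L'(T,1)/(Ω_T·Reg_T)) ≤ 1`» ⟹ the clause of `KolyvaginDepthSupplyKN` at `W = 707a1` VERBATIM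
(`cruxBody_of_twistBSDQuotient_intrinsic_zhang`). CONDITIONAL on Stein–Wuthrich Thm. 1.1, W. Zhang L8.4 (1) / 9.1 and Thm. 1.6, GZK by name; per curve;
nothing class-wide; BSD is not proved by it. [cite: WZhang2014, Thm. 1.6 (p. 199), Thm. 1.4 (2)–(3) (p. 197)] [cite: SteinWuthrich2013, Thm. 1.1 (p. 1758)]
[cite: CremonaAlgorithms1997, Table 1 (707a1)] -/
theorem cruxBody_intrinsic_zhang_at
    (hSW : SteinWuthrich2013_sha_inf_torsionBy_eq_bot_of_two_le_rank)
    (h84 : Literature.NumberTheory.EllipticCurves.WZhang2014_lemma84_exists_minimal_kolyvaginClass_one_selmerCard)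
    (hZ : WZhang2014_padicValRat_bsd_rank_one_ordinary) (hGZK : rank_eq_analyticRank_of_analyticRank_le_one)
    (p : ℕ) [hp : Fact p.Prime] (h5 : 5 ≤ p) (hp1000 : p < 1000)
    (hgood : haveI := isElliptic_c707a1; haveI := isGloballyMinimal_c707a1; ((⟨0, 1, 1, -12, 12⟩ : WeierstrassCurve ℤ).map (Int.castRingHom ℚ)).HasGoodReductionAtPrime p)
    (hord : haveI := isElliptic_c707a1; haveI := isGloballyMinimal_c707a1; ¬ (p : ℤ) ∣ ((⟨0, 1, 1, -12, 12⟩ : WeierstrassCurve ℤ).map (Int.castRingHom ℚ)).frobeniusTrace p)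
    (htower : haveI := isElliptic_c707a1; haveI := isGloballyMinimal_c707a1; ∀ n : ℕ, ((⟨0, 1, 1, -12, 12⟩ : WeierstrassCurve ℤ).map (Int.castRingHom ℚ)).HasSurjectiveModNGaloisRep (p ^ n : ℕ))
    (K : Type) [Field K] [NumberField K] (hK : IsImaginaryQuadratic K)
    (hodd : Odd (NumberField.discr K)) (hsqf : Squarefree (NumberField.discr K))
    (hD3 : NumberField.discr K ≠ -3) (hD4 : NumberField.discr K ≠ -4) (hpD : ¬ ((p : ℤ) ∣ NumberField.discr K))
    (hH : SatisfiesHeegnerHypothesis 707 K)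
    (T : WeierstrassCurve ℚ) [T.IsElliptic] [T.IsGloballyMinimal] (C : WeierstrassCurve.VariableChange ℚ)
    (hC : C • T = ((⟨0, 1, 1, -12, 12⟩ : WeierstrassCurve ℤ).map (Int.castRingHom ℚ)).quadraticTwist (NumberField.discr K : ℚ))
    (hTr : (((⟨0, 1, 1, -12, 12⟩ : WeierstrassCurve ℤ).map (Int.castRingHom ℚ)).quadraticTwist (NumberField.discr K : ℚ)).analyticRank = 1)
    (hval : ∀ q : ℚ, T.leadingLCoeff / ((T.realPeriodRat * T.regulator : ℝ) : ℂ) = (q : ℂ) → padicValRat p q ≤ 1) :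
    haveI := isElliptic_c707a1; haveI := isGloballyMinimal_c707a1;
    ∃ (p : ℕ) (hp : Fact p.Prime), 5 ≤ p ∧ ((⟨0, 1, 1, -12, 12⟩ : WeierstrassCurve ℤ).map (Int.castRingHom ℚ)).HasGoodReductionAtPrime p ∧
      ¬ (p : ℤ) ∣ ((⟨0, 1, 1, -12, 12⟩ : WeierstrassCurve ℤ).map (Int.castRingHom ℚ)).frobeniusTrace p ∧ (∀ n : ℕ, ((⟨0, 1, 1, -12, 12⟩ : WeierstrassCurve ℤ).map (Int.castRingHom ℚ)).HasSurjectiveModNGaloisRep (p ^ n : ℕ)) ∧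
      (∀ v : HeightOneSpectrum (𝓞 ℚ), ((⟨0, 1, 1, -12, 12⟩ : WeierstrassCurve ℤ).map (Int.castRingHom ℚ)).HasMultiplicativeReductionAt v →
        ¬ p ∣ ((⟨0, 1, 1, -12, 12⟩ : WeierstrassCurve ℤ).map (Int.castRingHom ℚ)).ordMinimalDiscriminant v) ∧
      ∃ (K : Type) (_ : Field K) (_ : NumberField K), IsImaginaryQuadratic K ∧
        NumberField.discr K ≠ -3 ∧ NumberField.discr K ≠ -4 ∧
        ∃ (_ : NeZero (((⟨0, 1, 1, -12, 12⟩ : WeierstrassCurve ℤ).map (Int.castRingHom ℚ)).conductorNorm ℤ)), SatisfiesHeegnerHypothesis (((⟨0, 1, 1, -12, 12⟩ : WeierstrassCurve ℤ).map (Int.castRingHom ℚ)).conductorNorm ℤ) K ∧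
        ∃ (Dt : ModularParametrizationData ((⟨0, 1, 1, -12, 12⟩ : WeierstrassCurve ℤ).map (Int.castRingHom ℚ)) (((⟨0, 1, 1, -12, 12⟩ : WeierstrassCurve ℤ).map (Int.castRingHom ℚ)).conductorNorm ℤ)) (β : ℤ) (ι : K →+* ℂ) (n₁ : ℕ)
          (d : KolyvaginHeegnerData Dt β ι n₁), Squarefree n₁ ∧
          (∀ q ∈ n₁.primeFactors, Zhang2014.IsKolyvaginPrime (((⟨0, 1, 1, -12, 12⟩ : WeierstrassCurve ℤ).map (Int.castRingHom ℚ)).conductorNorm ℤ) ((⟨0, 1, 1, -12, 12⟩ : WeierstrassCurve ℤ).map (Int.castRingHom ℚ)) K p q) ∧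
          d.kolyvaginClass hp.out 1 ≠ 0 ∧
          (n₁.primeFactors.card + 1 ≤ ((⟨0, 1, 1, -12, 12⟩ : WeierstrassCurve ℤ).map (Int.castRingHom ℚ)).mordellWeilRank ∨
            (n₁.primeFactors.card ≤ ((⟨0, 1, 1, -12, 12⟩ : WeierstrassCurve ℤ).map (Int.castRingHom ℚ)).mordellWeilRank ∧
              n₁.primeFactors.card + 1 ≤ (((⟨0, 1, 1, -12, 12⟩ : WeierstrassCurve ℤ).map (Int.castRingHom ℚ)).quadraticTwist (NumberField.discr K : ℚ)).mordellWeilRank)) := by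
  haveI := isElliptic_c707a1; haveI := isGloballyMinimal_c707a1
  haveI iNZ : NeZero (((⟨0, 1, 1, -12, 12⟩ : WeierstrassCurve ℤ).map (Int.castRingHom ℚ)).conductorNorm ℤ) := neZero_conductorNorm_of_isElliptic _
  have hsp := spadeOne_of_five_le p h5
  have hHN : SatisfiesHeegnerHypothesis (((⟨0, 1, 1, -12, 12⟩ : WeierstrassCurve ℤ).map (Int.castRingHom ℚ)).conductorNorm ℤ) K := by rw [conductorNorm_eq]; exact hH
  have htwo : ∃ (ℓ₁ ℓ₂ : ℕ) (_ : Fact ℓ₁.Prime) (_ : Fact ℓ₂.Prime), ℓ₁ ≠ ℓ₂ ∧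
      ((⟨0, 1, 1, -12, 12⟩ : WeierstrassCurve ℤ).map (Int.castRingHom ℚ)).HasMultiplicativeReductionAtPrime ℓ₁ ∧ ((⟨0, 1, 1, -12, 12⟩ : WeierstrassCurve ℤ).map (Int.castRingHom ℚ)).HasMultiplicativeReductionAtPrime ℓ₂ := by
    haveI i₁ := Fact.mk (by norm_num : Nat.Prime 7)
    haveI i₂ := Fact.mk (by norm_num : Nat.Prime 101)
    exact ⟨7, 101, i₁, i₂, by norm_num,
      IntModel.hasMultiplicativeReductionAtPrime_of_intModel intModel 7 (by decide +kernel) (by decide +kernel),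
      IntModel.hasMultiplicativeReductionAtPrime_of_intModel intModel 101 (by decide +kernel) (by decide +kernel)⟩
  exact cruxBody_of_twistBSDQuotient_intrinsic_zhang hSW h84 hZ hGZK _ not_hasCM KernelCerts002.C707a1.two_le_rank (by rw [conductorNorm_eq]; norm_num) p h5 hp1000
    hgood hord htower (kodairaNeron_of_five_le p h5) hsp.1 htwo K hK hodd hsqf hD3 hD4 hpD hHN T C hC hTr 1 KernelCerts002.C707a1.two_le_rank hval

end C707a1

end Summit.BirchSwinnertonDyer.BirchSwinnertonDyer.Theorems.KolyvaginDepthDoor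

end
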